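import Summits.ResolutionOfSingularities.ResolutionOfSingularities.Theorems.PurelyInseparableDim4ResConeLayerBirths
import Summits.ResolutionOfSingularities.ResolutionOfSingularities.Theorems.PurelyInseparableDim4ChartDictionary
import HarnessLib
import HarnessLib.Audit.Tags

/-!
# Purely inseparable four-folds — the RESIDUAL TRANSFORM LAW of a point step
# (cell `res-dim4-pi`, K2(p) lane, slice B brick K5(a))

[OURS · counted 0 · cell `res-dim4-pi` · K2(p) lane holder res-dim4-p-12 g3's SLICE-B ARCHITECTURE MEMO v1
(`SLICE-B-ARCH-g3.md` 0430a5173a152fb1; desk WORD #88 (a); signatures res-dim4-p-12 g3 2026-08-28 23:08Z),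
brick K5(a), seat res-dim4-p-9 g3.]  Nothing here proves K2(p), `NoIsolatedTrap p p` or resolution of
singularities in dimension ≥ 4 / characteristic `p`.

At a point step (chart `x_j`, point `b` with `b_j = 0`) of a state `s = (F, r, exc)` with `x^r ∣ F`,
`ord₀ F = o ≥ q`, write `G := F / x^r` (the residual) and `s′ := CentreBlowup.step q univ j b s`.  The RAW
polynomial of the step is `chartTransform q univ j (shear j b F)` (`…ResConeNear`), the cleaned one `s′.F` is
it minus its `q`-th-power monomials.  This file proves the transform law of the residual:

* §1 chart-transform calculus on `K[x₁..x₄]`: `x_j^m · chartTransform m = σ_j` (typ-2's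
  `ChartDictionary.coordBlowupSubst_eq_X_pow_mul_chartTransform`), hence **`chartTransform_mul`**
  (multiplicativity under the degree hypotheses) and `chartTransform_eq_X_pow_mul_chartTransform`.
* §2 **`chartTransform_shear_monomial`**: `chartTransform |r| (shear j b x^r) = x^{(r|_{b=0}) ∖ j} · ∏_{b_i ≠ 0} (x_i + b_i)^{r_i}`
  — the kept letters stay, the lost letters become the UNITS `(x_i + b_i)^{r_i}`.
* §3 **`chartTransform_shear_eq_monomial_mul`** / **`divMonomial_chartTransform_shear`**: the raw transform is
  `x^{r′} · (∏_{b_i ≠ 0} (x_i + b_i)^{r_i}) · chartTransform (o − |r|) (shear j b G)` with `r′ = s′.r`, so the RAW new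
  residual is «lost units × chart transform of the sheared residual» — no shade hypothesis.
* §4 **`divMonomial_step_F_add_deleted`**: the CLEANED new residual `s′.F / x^{r′}` differs from the raw one by
  the deleted `q`-th-power monomials divided by `x^{r′}` (all of them are multiples of `x^{r′}`).

bears_on: LADDER-RESOLUTION:D157-DOOR2 (res-dim4-pi · K2(p) · slice B · K5(a)).  Supports
stmt-ResolutionOfSingularities-16155 (helper).
-/

set_option linter.dupNamespace false -- mandated namespace of this single-conjunct summit

noncomputable section

namespace Summit.ResolutionOfSingularities.ResolutionOfSingularities.Theorems.PIDim4

namespace ResCone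

open MvPolynomial Finset
open Literature.AlgebraicGeometry.Resolution
open Literature.AlgebraicGeometry.Resolution.CentreBlowup
open Literature.AlgebraicGeometry.Resolution.Hauser2010
open Literature.AlgebraicGeometry.Resolution.HauserPerlega2019

variable {K : Type} [Field K]

/-! ## 1. Chart-transform calculus -/

/-- `x_j^m · chartTransform m univ j P = σ_j(P)` (the blow-up substitution `x_i ↦ x_j x_i`, `i ≠ j`) when every
monomial of `P` has degree `≥ m` (typ-2's dictionary at `S = univ`). [folklore] -/
theorem X_pow_mul_chartTransform_univ (j : Fin 4) {m : ℕ} {P : MvPolynomial (Fin 4) K}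
    (hP : ∀ e ∈ P.support, m ≤ e.degree) :
    (X j : MvPolynomial (Fin 4) K) ^ m * chartTransform m Finset.univ j P =
      coordBlowupSubst K (↑(Finset.univ : Finset (Fin 4))) j P :=
  (ChartDictionary.coordBlowupSubst_eq_X_pow_mul_chartTransform (Finset.mem_univ j) m P
    (le_ordAlong_of_forall fun d hd => by rw [degIn_univ]; exact hP d hd)).symm

/-- Degrees add on the support of a product. [folklore] -/
theorem forall_le_degree_mul {m n : ℕ} {P Q : MvPolynomial (Fin 4) K}
    (hP : ∀ e ∈ P.support, m ≤ e.degree) (hQ : ∀ e ∈ Q.support, n ≤ e.degree) :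
    ∀ e ∈ (P * Q).support, m + n ≤ e.degree := by
  classical
  intro e he
  obtain ⟨d₁, hd₁, d₂, hd₂, rfl⟩ := Finset.mem_add.mp (MvPolynomial.support_mul P Q he)
  rw [map_add]
  exact add_le_add (hP d₁ hd₁) (hQ d₂ hd₂)

/-- **`chartTransform` is multiplicative** under the degree hypotheses: if the monomials of `P` have degree
`≥ m` and those of `Q` degree `≥ n`, then `chartTransform (m + n) (P·Q) = chartTransform m P · chartTransform n Q`
(both sides times `x_j^{m+n}` are `σ_j(P·Q) = σ_j(P)·σ_j(Q)`). [folklore] -/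
theorem chartTransform_mul (j : Fin 4) {m n : ℕ} {P Q : MvPolynomial (Fin 4) K}
    (hP : ∀ e ∈ P.support, m ≤ e.degree) (hQ : ∀ e ∈ Q.support, n ≤ e.degree) :
    chartTransform (m + n) Finset.univ j (P * Q) =
      chartTransform m Finset.univ j P * chartTransform n Finset.univ j Q := by
  have h := X_pow_mul_chartTransform_univ j (forall_le_degree_mul hP hQ)
  rw [map_mul, ← X_pow_mul_chartTransform_univ j hP, ← X_pow_mul_chartTransform_univ j hQ,
    mul_mul_mul_comm, ← pow_add] at h
  exact mul_left_cancel₀ (pow_ne_zero _ (X_ne_zero j)) h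

/-- Lowering the division exponent: `chartTransform m P = x_j^{o − m} · chartTransform o P` for `m ≤ o` when the
monomials of `P` have degree `≥ o`. [folklore] -/
theorem chartTransform_eq_X_pow_mul_chartTransform (j : Fin 4) {m o : ℕ} (hmo : m ≤ o)
    {P : MvPolynomial (Fin 4) K} (hP : ∀ e ∈ P.support, o ≤ e.degree) :
    chartTransform m Finset.univ j P = X j ^ (o - m) * chartTransform o Finset.univ j P := by
  have h := X_pow_mul_chartTransform_univ j hP
  rw [← X_pow_mul_chartTransform_univ j (fun e he => hmo.trans (hP e he)), ← Nat.add_sub_cancel' hmo,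
    pow_add, mul_assoc, Nat.add_sub_cancel' hmo] at h
  exact (mul_left_cancel₀ (pow_ne_zero _ (X_ne_zero j)) h).symm

/-- The shear does not lower degrees on the support. [folklore] -/
theorem forall_le_degree_shear [DecidableEq K] (j : Fin 4) (b : Fin 4 → K) {n : ℕ}
    {P : MvPolynomial (Fin 4) K} (hP : ∀ e ∈ P.support, n ≤ e.degree) :
    ∀ e ∈ (shear j b P).support, n ≤ e.degree := by
  intro e he
  have h := le_ordAlong_iff.mp (Straightening.le_ordAlong_univ_shear j b
    (le_ordAlong_of_forall (S := Finset.univ) (F := P) fun d hd => by rw [degIn_univ]; exact hP d hd)) e he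
  rw [degIn_univ] at h
  exact_mod_cast h

/-- `ord₀ F = o` bounds the degrees on the support from below. [folklore] -/
theorem forall_le_degree_of_ordZero_eq {F : MvPolynomial (Fin 4) K} {o : ℕ} (ho : ordZero F = o) :
    ∀ e ∈ F.support, o ≤ e.degree := by
  intro e he
  by_contra h
  exact (MvPolynomial.mem_support_iff.mp he) (((ordZero_eq_nat_iff F o).mp ho).2 e (by omega))

/-! ## 2. The chart transform of the sheared boundary monomial -/

/-- **`chartTransform |r| (shear j b x^r) = x^{(r|_{b = 0}) ∖ j} · ∏_{b_i ≠ 0} (x_i + b_i)^{r_i}`**: under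
`σ_j ∘ shear`, `x_j ↦ x_j`, a kept letter `x_i ↦ x_j x_i`, a lost letter `x_i ↦ x_j (x_i + b_i)`; dividing by
`x_j^{|r|}` leaves the kept monomial (without `x_j`) times the lost units. [folklore] -/
theorem chartTransform_shear_monomial [DecidableEq K] (j : Fin 4) {b : Fin 4 → K} (hbj : b j = 0)
    (r : Fin 4 →₀ ℕ) :
    chartTransform r.degree Finset.univ j (shear j b (monomial r (1 : K))) =
      monomial ((r.filter fun i => b i = 0).erase j) 1 *
        ∏ i ∈ Finset.univ.filter (fun i => b i ≠ 0), (X i + C (b i)) ^ (r i) := by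
  have hhom : ∀ e ∈ (shear j b (monomial r (1 : K))).support, r.degree ≤ e.degree := by
    intro e he
    have h := Straightening.isHomogeneous_shear_monomial j b r (1 : K) (MvPolynomial.mem_support_iff.mp he)
    rw [weight_one_eq_degree] at h
    exact h.ge
  apply mul_left_cancel₀ (pow_ne_zero r.degree (X_ne_zero j))
  rw [X_pow_mul_chartTransform_univ j hhom]
  -- compute `σ_j (shear x^r)` letter by letter
  have hfac : ∀ i : Fin 4, coordBlowupSubst K (↑(Finset.univ : Finset (Fin 4))) j
      (shear j b ((X i : MvPolynomial (Fin 4) K) ^ r i)) =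
      X j ^ r i * ((X i : MvPolynomial (Fin 4) K) ^ ((r.filter fun i => b i = 0).erase j) i *
        (if b i ≠ 0 then (X i + C (b i)) ^ r i else 1)) := by
    intro i
    unfold shear
    rw [map_pow, map_pow, aeval_X]
    by_cases hij : i = j
    · subst hij
      rw [if_pos rfl, coordBlowupSubst_X_self, Finsupp.erase_same, pow_zero, if_neg (not_not.mpr hbj),
        mul_one, mul_one]
    · rw [if_neg hij, map_add, map_mul, coordBlowupSubst_C, coordBlowupSubst_X_self,
        coordBlowupSubst_X_of_mem_of_ne K _ j (Finset.mem_coe.mpr (Finset.mem_univ i)) hij,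
        Finsupp.erase_ne hij, Finsupp.filter_apply]
      by_cases hbi : b i = 0
      · rw [hbi, C_0, zero_mul, add_zero, if_pos rfl, if_neg (not_not.mpr rfl), mul_one, mul_pow]
      · rw [if_neg hbi, if_pos hbi, pow_zero, one_mul, ← mul_pow, mul_add, mul_comm (C (b i)) (X j)]
  rw [monomial_eq, C_1, one_mul, Finsupp.prod_fintype _ _ (fun i => pow_zero _)]
  unfold shear
  rw [map_prod, map_prod]
  change ∏ i, coordBlowupSubst K (↑(Finset.univ : Finset (Fin 4))) j (shear j b (X i ^ r i)) = _
  simp_rw [hfac]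
  rw [Finset.prod_mul_distrib, Finset.prod_mul_distrib, Finset.prod_pow_eq_pow_sum, ← Finset.prod_filter,
    monomial_eq, C_1, one_mul, Finsupp.prod_fintype _ _ (fun i => pow_zero _)]
  congr 2
  rw [Finsupp.degree_eq_sum]

/-! ## 3. The raw transform factors through the new boundary monomial -/

/-- `divMonomial` is additive over finite sums. [folklore] -/
theorem sum_divMonomial {ι : Type*} (S : Finset ι) (f : ι → MvPolynomial (Fin 4) K) (a : Fin 4 →₀ ℕ) :
    (∑ i ∈ S, f i).divMonomial a = ∑ i ∈ S, (f i).divMonomial a := by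
  classical
  induction S using Finset.induction_on with
  | empty => rw [Finset.sum_empty, Finset.sum_empty, zero_divMonomial]
  | insert i S hi ih => rw [Finset.sum_insert hi, Finset.sum_insert hi, add_divMonomial, ih]

/-- A polynomial is its cleaning plus its `q`-th-power monomials. [folklore] -/
theorem deletePthPowers_add_sum_filter (q : ℕ) (P : MvPolynomial (Fin 4) K) :
    deletePthPowers q P + ∑ d ∈ P.support with IsPthPowerExponent q d, monomial d (coeff d P) = P := by
  unfold deletePthPowers
  rw [add_comm, Finset.sum_filter_add_sum_filter_not]
  exact (MvPolynomial.as_sum P).symm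

section Step

variable [DecidableEq K]

/-- The new boundary monomial: `x^{r′} = x^{(r|_{b=0}) ∖ j} · x_j^{o − q}`. [folklore] -/
theorem monomial_step_r_eq (q : ℕ) (j : Fin 4) {b : Fin 4 → K} (hbj : b j = 0) (s : State K) {o : ℕ}
    (ho : ordZero s.F = o) (hr : ∀ d ∈ s.F.support, s.r ≤ d) :
    monomial (CentreBlowup.step q Finset.univ j b s).r (1 : K) =
      monomial ((s.r.filter fun i => b i = 0).erase j) 1 * X j ^ (o - q) := by
  rw [step_r_univ q j hbj s ho hr, Finsupp.update_eq_erase_add_single, monomial_add_single]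

/-- **THE RAW TRANSFORM FACTORS THROUGH `x^{r′}`**: for `x^r ∣ F`, `ord₀ F = o ≥ q`, `b_j = 0`,
`chartTransform q (shear j b F) = x^{r′} · (∏_{b_i ≠ 0} (x_i + b_i)^{r_i}) · chartTransform (o − |r|) (shear j b G)`,
`G = F / x^r`, `r′` the new boundary. [folklore] -/
theorem chartTransform_shear_eq_monomial_mul {q : ℕ} (j : Fin 4) {b : Fin 4 → K} (hbj : b j = 0) {s : State K}
    {o : ℕ} (ho : ordZero s.F = o) (hr : ∀ d ∈ s.F.support, s.r ≤ d) (hqo : q ≤ o) :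
    chartTransform q Finset.univ j (shear j b s.F) =
      monomial (CentreBlowup.step q Finset.univ j b s).r 1 *
        ((∏ i ∈ Finset.univ.filter (fun i => b i ≠ 0), (X i + C (b i)) ^ (s.r i)) *
          chartTransform (o - s.r.degree) Finset.univ j (shear j b (s.F.divMonomial s.r))) := by
  have hro : s.r.degree ≤ o := degree_r_le ho hr
  -- degrees on the supports
  have hF : ∀ e ∈ (shear j b s.F).support, o ≤ e.degree :=
    forall_le_degree_shear j b (forall_le_degree_of_ordZero_eq ho)
  have hG : ∀ e ∈ (s.F.divMonomial s.r).support, o - s.r.degree ≤ e.degree := by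
    intro e he
    rw [MvPolynomial.mem_support_iff, coeff_divMonomial] at he
    have h := forall_le_degree_of_ordZero_eq ho (s.r + e) (MvPolynomial.mem_support_iff.mpr he)
    rw [map_add] at h
    omega
  have hshG := forall_le_degree_shear j b hG
  have hshr : ∀ e ∈ (shear j b (monomial s.r (1 : K))).support, s.r.degree ≤ e.degree := by
    intro e he
    have h := Straightening.isHomogeneous_shear_monomial j b s.r (1 : K) (MvPolynomial.mem_support_iff.mp he)
    rw [weight_one_eq_degree] at h
    exact h.ge
  have hsplit : chartTransform o Finset.univ j (shear j b (monomial s.r (1 : K)) * shear j b (s.F.divMonomial s.r)) =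
      chartTransform s.r.degree Finset.univ j (shear j b (monomial s.r (1 : K))) *
        chartTransform (o - s.r.degree) Finset.univ j (shear j b (s.F.divMonomial s.r)) := by
    have h := chartTransform_mul j hshr hshG
    rwa [Nat.add_sub_cancel' hro] at h
  rw [chartTransform_eq_X_pow_mul_chartTransform j hqo hF, shear_F_eq_shear_monomial_mul hr j b, hsplit,
    chartTransform_shear_monomial j hbj, monomial_step_r_eq q j hbj s ho hr]
  ring

/-- **THE RAW NEW RESIDUAL** (slice B brick K5(a)): `x^r ∣ F`, `ord₀ F = o ≥ q`, `b_j = 0` ⇒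
`chartTransform q (shear j b F) / x^{r′} = (∏_{b_i ≠ 0} (x_i + b_i)^{r_i}) · chartTransform (o − |r|) (shear j b G)`
— lost units times the chart transform of the sheared residual; NO shade hypothesis. [folklore] -/
theorem divMonomial_chartTransform_shear {q : ℕ} (j : Fin 4) {b : Fin 4 → K} (hbj : b j = 0) {s : State K}
    {o : ℕ} (ho : ordZero s.F = o) (hr : ∀ d ∈ s.F.support, s.r ≤ d) (hqo : q ≤ o) :
    (chartTransform q Finset.univ j (shear j b s.F)).divMonomial (CentreBlowup.step q Finset.univ j b s).r =
      (∏ i ∈ Finset.univ.filter (fun i => b i ≠ 0), (X i + C (b i)) ^ (s.r i)) *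
        chartTransform (o - s.r.degree) Finset.univ j (shear j b (s.F.divMonomial s.r)) := by
  rw [chartTransform_shear_eq_monomial_mul j hbj ho hr hqo, divMonomial_monomial_mul]

/-- Every monomial of the raw transform is a multiple of `x^{r′}`. [folklore] -/
theorem step_r_le_of_mem_support_chartTransform_shear {q : ℕ} (j : Fin 4) {b : Fin 4 → K} (hbj : b j = 0)
    {s : State K} {o : ℕ} (ho : ordZero s.F = o) (hr : ∀ d ∈ s.F.support, s.r ≤ d) (hqo : q ≤ o)
    {E : Fin 4 →₀ ℕ} (hE : E ∈ (chartTransform q Finset.univ j (shear j b s.F)).support) :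
    (CentreBlowup.step q Finset.univ j b s).r ≤ E := by
  rw [chartTransform_shear_eq_monomial_mul j hbj ho hr hqo, MvPolynomial.mem_support_iff,
    coeff_monomial_mul'] at hE
  by_contra h
  exact hE (if_neg h)

/-! ## 4. The cleaned new residual -/

/-- **THE CLEANED NEW RESIDUAL** (slice B brick K5(a), second half): `s′.F / x^{r′}` plus the deleted
`q`-th-power monomials of the raw transform divided by `x^{r′}` equals the raw new residual
`(∏_{b_i ≠ 0} (x_i + b_i)^{r_i}) · chartTransform (o − |r|) (shear j b G)`. [folklore] -/
theorem divMonomial_step_F_add_deleted {q : ℕ} (j : Fin 4) {b : Fin 4 → K} (hbj : b j = 0) {s : State K}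
    {o : ℕ} (ho : ordZero s.F = o) (hr : ∀ d ∈ s.F.support, s.r ≤ d) (hqo : q ≤ o) :
    (CentreBlowup.step q Finset.univ j b s).F.divMonomial (CentreBlowup.step q Finset.univ j b s).r +
      ∑ E ∈ (chartTransform q Finset.univ j (shear j b s.F)).support with IsPthPowerExponent q E,
        monomial (E - (CentreBlowup.step q Finset.univ j b s).r)
          (coeff E (chartTransform q Finset.univ j (shear j b s.F))) =
      (∏ i ∈ Finset.univ.filter (fun i => b i ≠ 0), (X i + C (b i)) ^ (s.r i)) *
        chartTransform (o - s.r.degree) Finset.univ j (shear j b (s.F.divMonomial s.r)) := by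
  have hq : (q : ℕ∞) ≤ ordAlong Finset.univ s.F := by rw [ordAlong_univ, ho]; exact_mod_cast hqo
  rw [← divMonomial_chartTransform_shear j hbj ho hr hqo, step_F_eq_deletePthPowers_chartTransform_shear q j hbj s hq]
  set T := chartTransform q Finset.univ j (shear j b s.F) with hT
  set r' := (CentreBlowup.step q Finset.univ j b s).r with hr'
  have hsum : ∑ E ∈ T.support with IsPthPowerExponent q E, monomial (E - r') (coeff E T) =
      (∑ E ∈ T.support with IsPthPowerExponent q E, monomial E (coeff E T)).divMonomial r' := by
    rw [sum_divMonomial]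
    refine Finset.sum_congr rfl fun E hE => ?_
    have hle : r' ≤ E :=
      step_r_le_of_mem_support_chartTransform_shear j hbj ho hr hqo (Finset.mem_filter.mp hE).1
    rw [show monomial E (coeff E T) = monomial r' (1 : K) * monomial (E - r') (coeff E T) by
      rw [monomial_mul, one_mul, add_tsub_cancel_of_le hle], divMonomial_monomial_mul]
  rw [hsum, ← add_divMonomial, deletePthPowers_add_sum_filter]

end Step

end ResCone

end Summit.ResolutionOfSingularities.ResolutionOfSingularities.Theorems.PIDim4
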